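import Literature.NumberTheory.Automorphic.UnitaryGroupIntegralPointsReductionRamified   -- ★ `natCard_residueField_eq_of_ramified` (+ ★ `natCard_residueField_valuativeRel_eq` via the inert file)
import Literature.NumberTheory.Automorphic.QuadraticAdeleBaseChange                      -- ★ `valued_toPlace_le_one_iff`
import Literature.NumberTheory.Automorphic.ValuedFieldValuativeRelBridge                 -- ★ `v_le_one_iff_mem_integer`, `v_eq_one_iff_valuation_eq_one`, `natCard_residueField_eq_of_compatible`
import HarnessLib

/-!
# THE RESIDUE BRIDGE `𝓀_v → 𝓀_w` ALONG `ι_w : F_v → E_w`, and its bijectivity at a RAMIFIED non-split place: `β̄ ∈ 𝓀_v²  ⟺  ι_w(β)‾ ∈ 𝓀_w²`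
# (Neukirch, ANT II §4 / I §8: `f(w|v) = 1` at a ramified prime of a quadratic extension; road «R1-ram», (R5b-σ) §3a, assembler F0P3a-p03 (g12))

Topic `NumberTheory/Automorphic`; namespace `Literature.NumberTheory.Automorphic.UnitaryGroup`.  THEOREMS ONLY (no definition, no instance, no notation, no named fact, no `sorry`).
Cell `pub/hodgecm-mathlib` (D-0151), crux H413 = `stmt-HodgeConjecture-24833`, line «N6nsGerm» stub `stub_N6nsR1LL`, residue ★ `RankOneUnstableTransferNonsplitCMERamified`.  HONEST LABEL:
HC_CM is proved only modulo the printed citations (hLiu418, h413) until rung 0 closes; this file is unconditional local algebra.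

WHY.  The (R5b-β) END brick (F0P3a-p03 (g12)) multiplies TWO residue signs at a tamely ramified place (B-p12 (g29) MEMO (R5b-α) (6′)): the Δ-side sign of the Cayley parameter
`β₀ ∈ 𝒪[L⁺_v]ˣ` — read by ★ B-p10 R-4b `hilbertSymbol_coe_eq_one_iff_isSquare_residue_of_odd` in the residue field `𝓀_v` of the `Valued` integers `Valued.integer (L⁺_v)` of the BASE
field — and the D-side bit of ★ B-p12 FILE 5, read in the residue field `𝓀_w` of the ValuativeRel integers `𝒪[L_w]` of the EXTENSION.  B-p12's identity `β̄₀ = ū ∕ (2 c̄ ḡ)` lives in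
`𝓀_w` (`u, c ∈ L_w`).  This file moves `β̄₀` across: `ι_w = toPlace v w` maps `Valued.integer (F_v)` into `𝒪[E_w]` as a LOCAL homomorphism (`|ι_w y|_w = |y|_v^{e(w|v)}`), so it induces
`ρ : 𝓀_v →+* 𝓀_w` (Mathlib `IsLocalRing.ResidueField.map`), injective; at a RAMIFIED non-split place `|𝓀_v| = |𝓞_F ∕ v| = |𝓀_w|` (★ `natCard_residueField_eq_of_ramified`, `f = 1`), so `ρ`
is a bijection and **squares correspond to squares**.  (At an inert place `ρ` is the degree-2 residue extension and every `x̄ ∈ 𝓀_v` is a square in `𝓀_w` — the `↔` is ramified-specific.)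

* §1 (any place `w ∣ v`): `toPlace_mem_integer` (`ι_w 𝒪_v ⊆ 𝒪_w`), `valued_toPlace_eq_one_iff` (`|ι_w y| = 1 ↔ |y| = 1`), `isUnit_toPlace_integer_iff`,
  `isSquare_residue_toPlace_of_isSquare_residue` (`β̄ ∈ 𝓀_v² ⇒ ι_w(β)‾ ∈ 𝓀_w²`).
* §2 (ramified non-split): **`isSquare_residue_toPlace_iff_of_ramified`** and its sign form **`ite_isSquare_residue_toPlace_eq_of_ramified`** (`[ι_w(β)‾] = [β̄]` in `{±1} ⊂ ℂ`).

## References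
* [NeukirchANT1999] J. Neukirch, *Algebraic Number Theory* (1999): Ch. I §8 Prop. (8.2) (`Σ eᵢfᵢ = n`), Ch. II §4 Prop. (4.3) (residue fields under completion).
* [Serre1979] J.-P. Serre, *Local Fields*, GTM 67 (1979): Ch. I §4 (ramification index and residue degree), Ch. V §3.
* [LabesseLanglands1979] J.-P. Labesse, R. P. Langlands, *L-indistinguishability for SL(2)*, Canad. J. Math. 31 (1979): §2 p. 9.
-/

set_option autoImplicit false

noncomputable section

open NumberField IsDedekindDomain IsLocalRing ValuativeRel
open scoped ValuativeRel

namespace Literature.NumberTheory.Automorphic.UnitaryGroup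

/-! ## §1 `ι_w` on integers: integral, local, squares go to squares -/

section AnyPlace

variable {F : Type} (E : Type) [Field F] [NumberField F] [Field E] [NumberField E] [Algebra F E]
  (v : HeightOneSpectrum (𝓞 F)) (w : PlacesOver E v)

/-- **`ι_w 𝒪_v ⊆ 𝒪_w`**: for `y` in the `Valued` integers of `F_v`, `toPlace v w y` lies in the ValuativeRel integers `𝒪[E_w]` (`|ι_w y|_w = |y|_v^e ≤ 1`, ★ `valued_toPlace_le_one_iff`).
[cite: NeukirchANT1999, Ch. II §4 Prop. (4.3)] -/
theorem toPlace_mem_integer (y : Valued.integer (v.adicCompletion F)) : toPlace v w (y : v.adicCompletion F) ∈ 𝒪[w.1.adicCompletion E] :=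
  (v_le_one_iff_mem_integer _).1 ((valued_toPlace_le_one_iff w (y : v.adicCompletion F)).2 ((Valuation.mem_integer_iff _ _).1 y.2))

/-- **`|ι_w y|_w = 1 ↔ |y|_v = 1`** (`e(w|v) ≥ 1`). [cite: NeukirchANT1999, Ch. II §4 Prop. (4.3)] -/
theorem valued_toPlace_eq_one_iff (y : v.adicCompletion F) : Valued.v (toPlace v w y) = 1 ↔ Valued.v y = 1 := by
  haveI := PlacesOver.liesOver (E := E) w
  rw [valued_toPlace]
  refine ⟨fun h => (pow_eq_one_iff.1 h).resolve_right (Ideal.IsDedekindDomain.ramificationIdx'_ne_zero_of_liesOver w.1.asIdeal v.ne_bot),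
    fun h => by rw [h, one_pow]⟩

/-- **`ι_w` on integers is LOCAL**: `⟨ι_w y, _⟩` is a unit of `𝒪[E_w]` iff `y` is a unit of `𝒪_v`. [cite: NeukirchANT1999, Ch. II §4 Prop. (4.3)] -/
theorem isUnit_toPlace_integer_iff (y : Valued.integer (v.adicCompletion F)) :
    IsUnit (⟨toPlace v w (y : v.adicCompletion F), toPlace_mem_integer E v w y⟩ : 𝒪[w.1.adicCompletion E]) ↔ IsUnit y := by
  rw [(Valuation.integer.integers (valuation (w.1.adicCompletion E))).isUnit_iff_valuation_eq_one,
    (Valuation.integer.integers (Valued.v (R := v.adicCompletion F))).isUnit_iff_valuation_eq_one]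
  change valuation (w.1.adicCompletion E) (toPlace v w (y : v.adicCompletion F)) = 1 ↔ Valued.v (y : v.adicCompletion F) = 1
  rw [← v_eq_one_iff_valuation_eq_one, valued_toPlace_eq_one_iff E v w]

/-- **Squares go to squares**: if `β̄` is a square in `𝓀_v` then `ι_w(β)‾` is a square in `𝓀_w` (lift `β̄ = ȳ²` to `β − y² ∈ 𝔪_v`, push through the local hom `ι_w`).
[cite: Serre1979, Ch. V §3] -/
theorem isSquare_residue_toPlace_of_isSquare_residue (β : Valued.integer (v.adicCompletion F))
    (h : IsSquare (residue (Valued.integer (v.adicCompletion F)) β)) :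
    IsSquare (residue 𝒪[w.1.adicCompletion E] ⟨toPlace v w (β : v.adicCompletion F), toPlace_mem_integer E v w β⟩) := by
  -- the integral restriction `φ` of `ι_w` is a local hom, and `residue ∘ φ = ResidueField.map φ ∘ residue`
  let φ : Valued.integer (v.adicCompletion F) →+* 𝒪[w.1.adicCompletion E] :=
    ((toPlace v w).comp (Valued.integer (v.adicCompletion F)).subtype).codRestrict 𝒪[w.1.adicCompletion E] fun y => toPlace_mem_integer E v w y
  haveI : IsLocalHom φ := ⟨fun y hy => (isUnit_toPlace_integer_iff E v w y).1 hy⟩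
  have hφ : (⟨toPlace v w (β : v.adicCompletion F), toPlace_mem_integer E v w β⟩ : 𝒪[w.1.adicCompletion E]) = φ β := rfl
  rw [hφ, ← ResidueField.map_residue]
  exact h.map _

end AnyPlace

/-! ## §2 Ramified non-split places: the residue map is a bijection, squares correspond -/

section Ramified

variable {F : Type} (E : Type) [Field F] [NumberField F] [Field E] [NumberField E] [Algebra F E] [Algebra.IsQuadraticExtension F E]
  (c : E ≃ₐ[F] E) (hc : c ≠ 1) (v : HeightOneSpectrum (𝓞 F)) (w : PlacesOver E v) (hw : c • w.1 = w.1)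

include hc hw in
/-- **`β̄ ∈ 𝓀_v² ⟺ ι_w(β)‾ ∈ 𝓀_w²` AT A RAMIFIED NON-SPLIT PLACE** (`c ≠ 1`, `c • w = w`, `e(w|v) ≠ 1`): the residue map `ρ : 𝓀_v →+* 𝓀_w` induced by `ι_w` is an injective ring hom between
finite fields of the same cardinality `|𝓞_F ∕ v|` (★ `natCard_residueField_eq_of_compatible`, ★ `natCard_residueField_valuativeRel_eq`, ★ `natCard_residueField_eq_of_ramified`:
`f(w|v) = 1`), hence a bijection; a square root of `ι_w(β)‾` pulls back.  This moves the Δ-side residue bit of ★ R-4b (`𝓀_v`) into the `𝓀_w` of ★ B-p12's bit.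
[cite: NeukirchANT1999, Ch. I §8 Prop. (8.2); Ch. II §4 Prop. (4.3)] [cite: Serre1979, Ch. I §4] -/
theorem isSquare_residue_toPlace_iff_of_ramified (he : v.asIdeal.ramificationIdx' w.1.asIdeal ≠ 1) (β : Valued.integer (v.adicCompletion F)) :
    IsSquare (residue 𝒪[w.1.adicCompletion E] ⟨toPlace v w (β : v.adicCompletion F), toPlace_mem_integer E v w β⟩) ↔
      IsSquare (residue (Valued.integer (v.adicCompletion F)) β) := by
  classical
  refine ⟨fun h => ?_, isSquare_residue_toPlace_of_isSquare_residue E v w β⟩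
  let φ : Valued.integer (v.adicCompletion F) →+* 𝒪[w.1.adicCompletion E] :=
    ((toPlace v w).comp (Valued.integer (v.adicCompletion F)).subtype).codRestrict 𝒪[w.1.adicCompletion E] fun y => toPlace_mem_integer E v w y
  haveI : IsLocalHom φ := ⟨fun y hy => (isUnit_toPlace_integer_iff E v w y).1 hy⟩
  let ρ : ResidueField (Valued.integer (v.adicCompletion F)) →+* ResidueField 𝒪[w.1.adicCompletion E] := ResidueField.map φ
  have hφ : (⟨toPlace v w (β : v.adicCompletion F), toPlace_mem_integer E v w β⟩ : 𝒪[w.1.adicCompletion E]) = φ β := rfl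
  rw [hφ, ← ResidueField.map_residue] at h
  -- `ρ` is a bijection: injective (field hom) between finite types of equal cardinality
  haveI : Finite (ResidueField 𝒪[w.1.adicCompletion E]) := inferInstance
  have hcard : Nat.card (ResidueField (Valued.integer (v.adicCompletion F))) = Nat.card (ResidueField 𝒪[w.1.adicCompletion E]) := by
    rw [show ResidueField (Valued.integer (v.adicCompletion F)) = Valued.ResidueField (v.adicCompletion F) from rfl,
      ← natCard_residueField_eq_of_compatible, natCard_residueField_valuativeRel_eq, natCard_residueField_eq_of_ramified c v hc w hw he]
  haveI : Finite (ResidueField (Valued.integer (v.adicCompletion F))) := Nat.finite_of_card_ne_zero (by rw [hcard]; exact Nat.card_pos.ne')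
  have hbij : Function.Bijective ρ := by
    rw [Nat.bijective_iff_injective_and_card]
    exact ⟨ρ.injective, hcard⟩
  obtain ⟨z, hz⟩ := h
  obtain ⟨y, rfl⟩ := hbij.2 z
  refine ⟨y, ρ.injective ?_⟩
  rw [hz, map_mul]

open scoped Classical in
include hc hw in
/-- **… in sign form**: `[ι_w(β)‾] = [β̄]` for the `{±1} ⊂ ℂ` signs `[x] := if IsSquare x then 1 else −1` — the Δ-side factor of the (R5b-σ) product read in `𝓀_w`.
[cite: NeukirchANT1999, Ch. II §4 Prop. (4.3)] [cite: LabesseLanglands1979, §2 p. 9] -/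
theorem ite_isSquare_residue_toPlace_eq_of_ramified (he : v.asIdeal.ramificationIdx' w.1.asIdeal ≠ 1) (β : Valued.integer (v.adicCompletion F)) :
    (if IsSquare (residue 𝒪[w.1.adicCompletion E] ⟨toPlace v w (β : v.adicCompletion F), toPlace_mem_integer E v w β⟩) then (1 : ℂ) else -1) =
      (if IsSquare (residue (Valued.integer (v.adicCompletion F)) β) then (1 : ℂ) else -1) := by
  rw [isSquare_residue_toPlace_iff_of_ramified E c hc v w hw he β]

end Ramified

end Literature.NumberTheory.Automorphic.UnitaryGroup

end
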